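import Summits.Ventures.YMGap.RobustBall.ConcentrationBall
import Summits.Ventures.YMGap.RobustBall.ErgodicAverages
import Summits.Ventures.YMGap.RobustBall.OneStateInvariant
import Summits.Ventures.YMGap.Thresholds.TorusStateResponse
import HarnessLib

/-!
# Venture YMGap, track ROBUST-BALL — «C-EST» on the WHOLE WINDOW: Gaussian and Chebyshev confidence for coupling read-outs (`SU(2)` on `ℤ⁴`)

HONEST FRAMING. WHAT THIS IS: a venture file (cell `pub-ymgap`, track Y2 ROBUST-BALL / DS, seat ds-3, theorems only, 0 compute, 0 defs), the companion
of `CouplingEstimation` (which it does not import). A READ-OUT is any `g : ℝ → ℝ` with the deterministic error-transfer property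
`e^{−216/25}/24 · |g(y) − b| ≤ |y − ⟨W⟩_μ|` for every tree coupling `b ∈ [0, 9/50)`, every DLR state `μ ∈ 𝒢(b)` and every real `y`
(`W = ½ Re tr U_{p₀}`, `p₀ = (0; 0, 1)`); `CouplingEstimation.su2_coupling_readout` constructs one (monotone, valued in `[0, 9/50]`). For the local
estimator `T_B = g(#B⁻¹ Σ_{x∈B} W∘θ_x)` over a finite nonempty set `B ⊂ ℤ⁴` of translates of ONE infinite-volume sample:

* ★★ `su2_couplingEstimator_tail_gauss` — `b ∈ [0, 1/24]` (Wilson `β_W ≤ 1/12`), every DLR state, every `ε ≥ 0`: Gaussian confidence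
  `μ{ε ≤ |T_B − b|} ≤ 2 exp(−2 (e^{−216/25} ε/24)² #B / (128 · 32² · 16 · Θ₁²))`, `Θ₁ = ((1+2^{−1/4})/(1−2^{−1/4}))⁴` (Dobrushin–Külske route,
  `su2_wilson_plaquette_average_upTo_oneTwelfth`);
* ★★ `su2_couplingEstimator_tail_chebyshev` — the WHOLE window `b ∈ [0, 9/50)` (Wilson `β_W < 9/25`), every DLR state: there is `C_b ≥ 0` with
  `μ{ε ≤ |T_B − b|} ≤ C_b/(ε² #B)` for every finite nonempty `B` and every `ε > 0` (second moments through the mass gap,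
  `ErgodicAverages.su2_wilson_ae_tendsto_boxAverage`) — consistency in probability at rate `#B^{−1}` on the whole strong-coupling window;
* ★★ `su2_couplingEstimator_ae_tendsto` — STRONG CONSISTENCY on the whole window: along the centred cubes `B_n`, `g(A_{B_n}(U)) → b` for `μ`-almost
  every `U`, every `b ∈ [0, 9/50)`, every DLR state `μ ∈ 𝒢(b)` (almost-sure ergodic theorem through the error transfer).

WHAT THIS IS NOT: the window is a finite set of plaquettes of an INFINITE-volume sample, not a finite-volume kernel with boundary condition; `C_b` of the
Chebyshev form is not explicit (it is the autocovariance sum delivered by the mass-gap row); lattice strong coupling; nothing about the continuum limit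
or Clay. Everything here is proved. [folklore]

References (context — consistency of coupling estimators for Gibbs random fields from one sample, Ising-type models): F. Comets, Ann. Statist. 20
(1992) 455–468; S. Chatterjee, Ann. Statist. 35 (2007) 1931–1946; B. B. Bhattacharya, S. Mukherjee, Bernoulli 24 (2018) 493–525 (arXiv:1507.07055).
The present file is the strong-coupling lattice-gauge case with a moment (mean-plaquette) read-out and explicit non-asymptotic confidence.
-/

noncomputable section

open MeasureTheory ProbabilityTheory Filter Topology Real Finset Set Function
open scoped NNReal ENNReal
open Literature.Probability.LatticeModels hiding configShift configShift_apply
open Literature.MathematicalPhysics.QuantumLattice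
open Literature.MathematicalPhysics.QuantumFieldTheory hiding ZdEdge Site IsLocalObservable

namespace Summit.Ventures.YMGap.RobustBall

namespace CouplingEstimation

section SU2

/-- ★★ **GAUSSIAN CONFIDENCE** (`SU(2)`, `d = 4`, tree couplings `b ∈ [0, 1/24]`, i.e. Wilson `β_W ≤ 1/12`): for any read-out `g` as in
`su2_coupling_readout`, every DLR state `μ ∈ 𝒢(b)`, every finite nonempty `B ⊂ ℤ⁴` and `ε ≥ 0`,
`μ{ε ≤ |g(A_B) − b|} ≤ 2 exp(−2 (e^{−216/25} ε/24)² #B / (128 · 32² · 16 · Θ₁²))`, `Θ₁ = ((1+2^{−1/4})/(1−2^{−1/4}))⁴`. [folklore] -/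
theorem su2_couplingEstimator_tail_gauss {g : ℝ → ℝ}
    (hg : ∀ b : ℝ, 0 ≤ b → b < 9 / 50 → ∀ μ : Measure (LGConfig 4 (SUN 2)), μ ∈ ymGibbsMeasures (d := 4) (fundamentalRep (Fin 2)) b →
      ∀ y : ℝ, Real.exp (-(216 / 25)) / 24 * |g y - b| ≤ |y - ∫ U, zdPlaquetteObs (fundamentalRep (Fin 2)) 0 0 1 U ∂μ|)
    {b : ℝ} (hb0 : 0 ≤ b) (hb : b ≤ 1 / 24) {μ : Measure (LGConfig 4 (SUN 2))}
    (hμ : μ ∈ ymGibbsMeasures (d := 4) (fundamentalRep (Fin 2)) b) {B : Finset (Literature.Probability.LatticeModels.Site 4)}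
    (hB : B.Nonempty) {ε : ℝ} (hε : 0 ≤ ε) :
    μ.real {U | ε ≤ |g ((∑ x ∈ B, zdPlaquetteObs (fundamentalRep (Fin 2)) 0 0 1 (configShift x U)) / B.card) - b|} ≤
      2 * Real.exp (-2 * (Real.exp (-(216 / 25)) / 24 * ε) ^ 2 * B.card / (128 * (32 : ℝ) ^ 2 * 16 *
        (((1 + Real.exp (Real.log (1 / 2) / 4)) / (1 - Real.exp (Real.log (1 / 2) / 4))) ^ 4) ^ 2)) := by
  classical
  have hG : IsGibbsMeasure (ymSpecification (d := 4) (fundamentalRep (Fin 2)) b) μ := hμ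
  haveI := hG.isProbabilityMeasure
  set F : LGConfig 4 (SUN 2) → ℝ := zdPlaquetteObs (fundamentalRep (Fin 2)) 0 0 1 with hF
  set p₀ : ZdPlaquette 4 := ((0 : Literature.Probability.LatticeModels.Site 4), ⟨((0 : Fin 4), (1 : Fin 4)), by decide⟩) with hp₀
  have hβ : (2 * b) / 2 = b := by ring
  have hμ' : μ ∈ ymGibbsMeasures (d := 4) (fundamentalRep (Fin 2)) ((2 * b) / 2) := by rw [hβ]; exact hμ
  have hBpos : (0 : ℝ) < B.card := by exact_mod_cast hB.card_pos
  have key := su2_wilson_plaquette_average_upTo_oneTwelfth (βW := 2 * b) (by linarith) (by linarith) hμ'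
    (0 : Literature.Probability.LatticeModels.Site 4) (show (0 : Fin 4) < 1 by decide) hB (a := Real.exp (-(216 / 25)) / 24 * ε) (by positivity)
  -- the centre: `∫ Σ_y W∘θ_y dμ = #B ⟨W⟩_μ` (the unique DLR state is translation invariant)
  have hcentre : ∫ U', ∑ y ∈ B, F (configShift y U') ∂μ = B.card * ∫ U, F U ∂μ := by
    obtain ⟨μ', h1, hinv⟩ := su2_wilson_oneState_translationInvariant (b := b) (abs_le.2 ⟨by linarith, by linarith⟩)
    have hμμ : μ = μ' := by rw [h1] at hμ; exact Set.mem_singleton_iff.1 hμ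
    rw [← hμμ] at hinv
    have hFm : Measurable F :=
      (isLipschitzCylinder_zdPlaquetteObs (N := 2) (d := 4) 0 (show (0 : Fin 4) < 1 by decide)).measurable
    have hFb : ∀ U, |F U| ≤ 1 := fun U => abs_zdPlaquetteObs_le (fun g => fundamentalRep_mem_unitaryGroup g) 0 0 1 U
    rw [integral_finsetSum _ fun x _ => ?_]
    · simp_rw [ErgodicAverages.integral_comp_shift hinv _]
      rw [Finset.sum_const, nsmul_eq_mul]
    · exact Literature.Probability.LatticeModels.DobrushinMetric.integrable_of_abs_le' (hFm.comp (configShift x).measurable) fun U => hFb _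
  -- event inclusion
  have hsub : {U | ε ≤ |g ((∑ x ∈ B, F (configShift x U)) / B.card) - b|} ⊆
      {U | Real.exp (-(216 / 25)) / 24 * ε * B.card ≤
        |(∑ y ∈ B, F (configShift y U)) - ∫ U', ∑ y ∈ B, F (configShift y U') ∂μ|} := by
    intro U hU
    have h1 := hg b hb0 (by linarith) μ hμ ((∑ x ∈ B, F (configShift x U)) / B.card)
    have h2 : Real.exp (-(216 / 25)) / 24 * ε ≤ |(∑ x ∈ B, F (configShift x U)) / B.card - ∫ U, F U ∂μ| :=
      (mul_le_mul_of_nonneg_left hU (by positivity)).trans h1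
    show Real.exp (-(216 / 25)) / 24 * ε * B.card ≤ |(∑ y ∈ B, F (configShift y U)) - ∫ U', ∑ y ∈ B, F (configShift y U') ∂μ|
    rw [hcentre]
    have e : (∑ y ∈ B, F (configShift y U)) - B.card * ∫ U, F U ∂μ =
        ((∑ x ∈ B, F (configShift x U)) / B.card - ∫ U, F U ∂μ) * B.card := by
      field_simp
    rw [e, abs_mul, abs_of_pos hBpos]
    exact mul_le_mul_of_nonneg_right h2 hBpos.le
  refine (measureReal_mono hsub).trans (key.trans ?_)
  -- constants: `#links(p₀)² ≤ 16`
  have hcard : ((plaquetteEdges p₀).card : ℝ) ≤ 4 := by exact_mod_cast card_plaquetteEdges_le p₀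
  have hmem : ((0 : Literature.Probability.LatticeModels.Site 4), (0 : Fin 4)) ∈ plaquetteEdges p₀ := by simp [hp₀, plaquetteEdges]
  have hcard1 : (1 : ℝ) ≤ (plaquetteEdges p₀).card := by exact_mod_cast Finset.card_pos.2 ⟨_, hmem⟩
  have hΘ : 0 < ((1 + Real.exp (Real.log (1 / 2) / 4)) / (1 - Real.exp (Real.log (1 / 2) / 4))) ^ 4 := by
    have hr1 : Real.exp (Real.log (1 / 2) / 4) < 1 := Real.exp_lt_one_iff.2 (by
      have : Real.log (1 / 2) < 0 := Real.log_neg (by norm_num) (by norm_num)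
      linarith)
    have hr0 : 0 < Real.exp (Real.log (1 / 2) / 4) := Real.exp_pos _
    positivity
  have hK : (((4 * (2 : ℝ≥0) ^ 3 : ℝ≥0) : ℝ)) = 32 := by push_cast; norm_num
  rw [hK]
  have hnum : 0 ≤ 2 * (Real.exp (-(216 / 25)) / 24 * ε) ^ 2 * B.card := by positivity
  have hD1 : 0 < 128 * (32 : ℝ) ^ 2 * ((plaquetteEdges p₀).card : ℝ) ^ 2 *
      (((1 + Real.exp (Real.log (1 / 2) / 4)) / (1 - Real.exp (Real.log (1 / 2) / 4))) ^ 4) ^ 2 := by positivity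
  have hD : 128 * (32 : ℝ) ^ 2 * ((plaquetteEdges p₀).card : ℝ) ^ 2 *
      (((1 + Real.exp (Real.log (1 / 2) / 4)) / (1 - Real.exp (Real.log (1 / 2) / 4))) ^ 4) ^ 2 ≤
      128 * (32 : ℝ) ^ 2 * 16 * (((1 + Real.exp (Real.log (1 / 2) / 4)) / (1 - Real.exp (Real.log (1 / 2) / 4))) ^ 4) ^ 2 := by
    have : ((plaquetteEdges p₀).card : ℝ) ^ 2 ≤ 16 := by nlinarith
    have hΘ2 : 0 ≤ (((1 + Real.exp (Real.log (1 / 2) / 4)) / (1 - Real.exp (Real.log (1 / 2) / 4))) ^ 4) ^ 2 := by positivity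
    nlinarith
  refine mul_le_mul_of_nonneg_left (Real.exp_le_exp.2 ?_) (by norm_num)
  have hmain := div_le_div_of_nonneg_left hnum hD1 hD
  simp only [div_eq_mul_inv] at hmain ⊢
  linarith
/-- ★★ **CHEBYSHEV CONFIDENCE ON THE WHOLE WINDOW** (`SU(2)`, `d = 4`, tree couplings `b ∈ [0, 9/50)`, Wilson `β_W < 9/25`): for any read-out `g`
as in `su2_coupling_readout` and every DLR state `μ ∈ 𝒢(b)` there is `C` with `μ{ε ≤ |g(A_B) − b|} ≤ C/(ε² #B)` for every finite nonempty
`B ⊂ ℤ⁴` and every `ε > 0` (second moments through the mass gap). [folklore] -/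
theorem su2_couplingEstimator_tail_chebyshev {g : ℝ → ℝ}
    (hg : ∀ b : ℝ, 0 ≤ b → b < 9 / 50 → ∀ μ : Measure (LGConfig 4 (SUN 2)), μ ∈ ymGibbsMeasures (d := 4) (fundamentalRep (Fin 2)) b →
      ∀ y : ℝ, Real.exp (-(216 / 25)) / 24 * |g y - b| ≤ |y - ∫ U, zdPlaquetteObs (fundamentalRep (Fin 2)) 0 0 1 U ∂μ|)
    {b : ℝ} (hb0 : 0 ≤ b) (hb : b < 9 / 50) {μ : Measure (LGConfig 4 (SUN 2))}
    (hμ : μ ∈ ymGibbsMeasures (d := 4) (fundamentalRep (Fin 2)) b) :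
    ∃ C : ℝ, 0 ≤ C ∧ ∀ B : Finset (Literature.Probability.LatticeModels.Site 4), B.Nonempty → ∀ ε : ℝ, 0 < ε →
      μ.real {U | ε ≤ |g ((∑ x ∈ B, zdPlaquetteObs (fundamentalRep (Fin 2)) 0 0 1 (configShift x U)) / B.card) - b|} ≤
        C / (ε ^ 2 * B.card) := by
  classical
  have hG : IsGibbsMeasure (ymSpecification (d := 4) (fundamentalRep (Fin 2)) b) μ := hμ
  haveI := hG.isProbabilityMeasure
  have hρc : Continuous (fundamentalRep (Fin 2)) := continuous_fundamentalRep (Fin 2)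
  set F : LGConfig 4 (SUN 2) → ℝ := zdPlaquetteObs (fundamentalRep (Fin 2)) 0 0 1 with hF
  -- the un-normalised plaquette `F' = Re tr U_{p₀} = 2 F` is a bounded measurable gauge-invariant local observable
  set F' : LGConfig 4 (SUN 2) → ℝ := plaquetteObs (fundamentalRep (Fin 2)) 0 0 1 with hF'
  have hloc : Literature.MathematicalPhysics.QuantumLattice.IsLocalObservable F' := ⟨_, isCylinder_plaquetteObs_zero (fundamentalRep (Fin 2)) 0 1⟩
  have hFm : Measurable F' := measurable_plaquetteObs _ hρc 0 0 1
  have hFb : ∃ C, ∀ U, |F' U| ≤ C :=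
    ⟨2, fun U => by simpa using abs_plaquetteObs_le_holds (fundamentalRep (Fin 2)) fundamentalRep_mem_unitaryGroup 0 0 1 U⟩
  have hFg : IsZdGaugeInvariant F' := isZdGaugeInvariant_plaquetteObs (fundamentalRep (Fin 2)) 0 0 1
  have hFF : ∀ U, F' U = 2 * F U := fun U => by
    simpa using CouplingResponse.plaquetteObs_fundamentalRep_eq_mul_zdPlaquetteObs (N := 2) (d := 4) 0 0 1 U
  obtain ⟨μ', h1, hμ'⟩ := ErgodicAverages.su2_wilson_ae_tendsto_boxAverage (b := b) (abs_le.2 ⟨by linarith, by linarith⟩)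
  have hμμ : μ = μ' := by rw [h1] at hμ; exact Set.mem_singleton_iff.1 hμ
  obtain ⟨C, hC⟩ := (hμ' F' hloc hFm hFb hFg).2
  rw [← hμμ] at hC
  have hc0 : 0 < Real.exp (-(216 / 25)) / 24 := by positivity
  refine ⟨max C 0 / (4 * (Real.exp (-(216 / 25)) / 24) ^ 2), by positivity, fun B hB ε hε => ?_⟩
  have hBpos : (0 : ℝ) < B.card := by exact_mod_cast hB.card_pos
  have hI : ∫ U, F' U ∂μ = 2 * ∫ U, F U ∂μ := by
    rw [← integral_const_mul]
    exact integral_congr_ae (ae_of_all _ hFF)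
  -- event inclusion
  have hsub : {U | ε ≤ |g ((∑ x ∈ B, F (configShift x U)) / B.card) - b|} ⊆
      {U | 2 * (Real.exp (-(216 / 25)) / 24 * ε) ≤ |(∑ x ∈ B, F' (configShift x U)) / B.card - ∫ U', F' U' ∂μ|} := by
    intro U hU
    have h1 := hg b hb0 hb μ hμ ((∑ x ∈ B, F (configShift x U)) / B.card)
    have h2 : Real.exp (-(216 / 25)) / 24 * ε ≤ |(∑ x ∈ B, F (configShift x U)) / B.card - ∫ U, F U ∂μ| :=
      (mul_le_mul_of_nonneg_left hU hc0.le).trans h1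
    show 2 * (Real.exp (-(216 / 25)) / 24 * ε) ≤ |(∑ x ∈ B, F' (configShift x U)) / B.card - ∫ U', F' U' ∂μ|
    have e : (∑ x ∈ B, F' (configShift x U)) / B.card - ∫ U', F' U' ∂μ = 2 * ((∑ x ∈ B, F (configShift x U)) / B.card - ∫ U, F U ∂μ) := by
      rw [hI, Finset.sum_congr rfl fun x _ => hFF (configShift x U), ← Finset.mul_sum]
      ring
    rw [e, abs_mul, abs_two]
    linarith
  have key := hC B hB (2 * (Real.exp (-(216 / 25)) / 24 * ε)) (by positivity)
  have hle : μ {U | ε ≤ |g ((∑ x ∈ B, F (configShift x U)) / B.card) - b|} ≤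
      ENNReal.ofReal (max C 0 / ((2 * (Real.exp (-(216 / 25)) / 24 * ε)) ^ 2 * B.card)) :=
    (measure_mono hsub).trans (key.trans (ENNReal.ofReal_le_ofReal
      (div_le_div_of_nonneg_right (le_max_left _ _) (by positivity))))
  have hfin : 0 ≤ max C 0 / ((2 * (Real.exp (-(216 / 25)) / 24 * ε)) ^ 2 * B.card) := by positivity
  calc μ.real {U | ε ≤ |g ((∑ x ∈ B, F (configShift x U)) / B.card) - b|}
      ≤ max C 0 / ((2 * (Real.exp (-(216 / 25)) / 24 * ε)) ^ 2 * B.card) := by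
        rw [measureReal_def]
        exact ENNReal.toReal_le_of_le_ofReal hfin hle
    _ = max C 0 / (4 * (Real.exp (-(216 / 25)) / 24) ^ 2) / (ε ^ 2 * B.card) := by
        field_simp
        ring

/-- ★★ **STRONG CONSISTENCY ON THE WHOLE WINDOW** (`SU(2)`, `d = 4`, tree couplings `b ∈ [0, 9/50)`): for any read-out `g` as in
`su2_coupling_readout` and every DLR state `μ ∈ 𝒢(b)`, the local estimators along the centred cubes converge to the true coupling almost
surely: `g(#B_n⁻¹ Σ_{x∈B_n} W(θ_x U)) → b` for `μ`-a.e. `U` (almost-sure ergodic theorem `ErgodicAverages.su2_wilson_ae_tendsto_boxAverage` through the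
deterministic error transfer). [folklore] -/
theorem su2_couplingEstimator_ae_tendsto {g : ℝ → ℝ}
    (hg : ∀ b : ℝ, 0 ≤ b → b < 9 / 50 → ∀ μ : Measure (LGConfig 4 (SUN 2)), μ ∈ ymGibbsMeasures (d := 4) (fundamentalRep (Fin 2)) b →
      ∀ y : ℝ, Real.exp (-(216 / 25)) / 24 * |g y - b| ≤ |y - ∫ U, zdPlaquetteObs (fundamentalRep (Fin 2)) 0 0 1 U ∂μ|)
    {b : ℝ} (hb0 : 0 ≤ b) (hb : b < 9 / 50) {μ : Measure (LGConfig 4 (SUN 2))}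
    (hμ : μ ∈ ymGibbsMeasures (d := 4) (fundamentalRep (Fin 2)) b) :
    ∀ᵐ U ∂μ, Tendsto (fun n : ℕ =>
      g ((∑ x ∈ siteBox 4 n, zdPlaquetteObs (fundamentalRep (Fin 2)) 0 0 1 (configShift x U)) / (siteBox 4 n).card)) atTop (𝓝 b) := by
  classical
  have hρc : Continuous (fundamentalRep (Fin 2)) := continuous_fundamentalRep (Fin 2)
  set F : LGConfig 4 (SUN 2) → ℝ := zdPlaquetteObs (fundamentalRep (Fin 2)) 0 0 1 with hF
  set F' : LGConfig 4 (SUN 2) → ℝ := plaquetteObs (fundamentalRep (Fin 2)) 0 0 1 with hF'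
  have hloc : Literature.MathematicalPhysics.QuantumLattice.IsLocalObservable F' := ⟨_, isCylinder_plaquetteObs_zero (fundamentalRep (Fin 2)) 0 1⟩
  have hFm : Measurable F' := measurable_plaquetteObs _ hρc 0 0 1
  have hFb : ∃ C, ∀ U, |F' U| ≤ C :=
    ⟨2, fun U => by simpa using abs_plaquetteObs_le_holds (fundamentalRep (Fin 2)) fundamentalRep_mem_unitaryGroup 0 0 1 U⟩
  have hFg : IsZdGaugeInvariant F' := isZdGaugeInvariant_plaquetteObs (fundamentalRep (Fin 2)) 0 0 1
  have hFF : ∀ U, F' U = 2 * F U := fun U => by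
    simpa using CouplingResponse.plaquetteObs_fundamentalRep_eq_mul_zdPlaquetteObs (N := 2) (d := 4) 0 0 1 U
  obtain ⟨μ', h1, hμ'⟩ := ErgodicAverages.su2_wilson_ae_tendsto_boxAverage (b := b) (abs_le.2 ⟨by linarith, by linarith⟩)
  have hμμ : μ = μ' := by rw [h1] at hμ; exact Set.mem_singleton_iff.1 hμ
  have hae := (hμ' F' hloc hFm hFb hFg).1
  rw [← hμμ] at hae
  have hG : IsGibbsMeasure (ymSpecification (d := 4) (fundamentalRep (Fin 2)) b) μ := hμ
  haveI := hG.isProbabilityMeasure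
  have hI : ∫ U, F' U ∂μ = 2 * ∫ U, F U ∂μ := by
    rw [← integral_const_mul]
    exact integral_congr_ae (ae_of_all _ hFF)
  have hc0 : 0 < Real.exp (-(216 / 25)) / 24 := by positivity
  filter_upwards [hae] with U hU
  -- the cube averages of `F = F'/2` converge to `∫ F dμ`
  have hA : ∀ n : ℕ, (∑ x ∈ siteBox 4 n, F (configShift x U)) / (siteBox 4 n).card =
      (1 / 2 : ℝ) * ((∑ x ∈ siteBox 4 n, F' (configShift x U)) / (siteBox 4 n).card) := fun n => by
    rw [Finset.sum_congr rfl fun x _ => hFF (configShift x U), ← Finset.mul_sum]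
    ring
  have hU2 : Tendsto (fun n : ℕ => (∑ x ∈ siteBox 4 n, F (configShift x U)) / (siteBox 4 n).card) atTop (𝓝 (∫ U', F U' ∂μ)) := by
    have h := hU.const_mul (1 / 2 : ℝ)
    rw [hI, show (1 / 2 : ℝ) * (2 * ∫ U', F U' ∂μ) = ∫ U', F U' ∂μ by ring] at h
    simpa only [hA] using h
  -- squeeze through the read-out inequality
  have hdev : Tendsto (fun n : ℕ => |(∑ x ∈ siteBox 4 n, F (configShift x U)) / (siteBox 4 n).card - ∫ U', F U' ∂μ| /
      (Real.exp (-(216 / 25)) / 24)) atTop (𝓝 0) := by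
    have h := ((continuous_abs.tendsto _).comp (hU2.sub_const (∫ U', F U' ∂μ))).div_const (Real.exp (-(216 / 25)) / 24)
    simpa using h
  refine tendsto_iff_norm_sub_tendsto_zero.2 (squeeze_zero (fun n => norm_nonneg _) (fun n => ?_) hdev)
  rw [Real.norm_eq_abs, le_div_iff₀ hc0, mul_comm]
  exact hg b hb0 hb μ hμ _

end SU2

end CouplingEstimation

end Summit.Ventures.YMGap.RobustBall

end
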